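import Literature.AlgebraicGeometry.Motives.FaltingsECOfAbelianVarietyFiniteProofs
import Literature.AlgebraicGeometry.Motives.TateAbelianFiniteLattice
import Literature.AlgebraicGeometry.Motives.AbelianVarietyIsogenyProofs
import Literature.NumberTheory.EllipticCurves.AbelianVarietyBridge
import Literature.NumberTheory.EllipticCurves.TateModuleFree
import HarnessLib

/-!
# Tate's isogeny criterion for elliptic curves over a finite field from the theory of abelian varieties

Final assembly of the decomposition of the named fact
`Literature.Hodge.isIsogenous_of_finite_iff_exists_tateModule_hom_ne_zero W W' ℓ`
(`Literature.AlgebraicGeometry.Motives.FaltingsEC`; Tate, Invent. Math. 2 (1966), Theorem 1;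
Silverman, *AEC*, Isogeny Theorem III.7.7(a): two elliptic curves over a finite field `k` are
`k`-isogenous iff there is a non-zero `Γ_k`-equivariant `ℤ_ℓ`-linear `T_ℓ E → T_ℓ E'`,
`ℓ ≠ char k`) along Tate's printed proof (Tate 1966, §2; Milne, *The Work of John Tate*, §4.3.1;
Kieffer 2024, §1.2.4), combining

* `Literature.AlgebraicGeometry.Motives.TateAbelianFiniteLattice`: Tate's lattice lemma
  `tateSubspaceRealization P ℓ` for every abelian variety `P` over a finite `k`, **proved** from
  the finiteness of `k`-isomorphism classes in each dimension (Milne 1986, Cor. 18.9) and the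
  lattice/isogeny dictionary (Kieffer Prop. 1.1.10, 1.1.12, 1.2.4, 1.2.5), via the compactness
  step of `TateLatticeLimitProofs`;
* `Literature.AlgebraicGeometry.Motives.TateAbelianFiniteSteps`: the graph argument (a non-zero
  equivariant `T_ℓ A → T_ℓ A'` and the lattice lemma for a biproduct `A ⊞ A'` give
  `Hom_k(A, A') ≠ 0 ∨ Hom_k(A', A) ≠ 0`);
* `Literature.AlgebraicGeometry.Motives.FaltingsECOfAbelianVarietyFiniteProofs`, section
  `LatticeLemma`: the transport to Weierstrass curves along bridge data.

## Result

`Literature.AlgebraicGeometry.Motives.isIsogenous_of_finite_iff_exists_tateModule_hom_ne_zero_of_abelianVariety_facts`: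
the named fact for `(W, W', ℓ)` follows from

1. five statements of the general theory of abelian varieties over `K`, each a named fact of the
   tree quantified over all abelian varieties over `K` — products
   (`AbelianVariety.hasBinaryBiproduct`, for the pair `(A, A')`), finiteness of isomorphism
   classes over a finite field (`finite_isoClasses_of_finite K g`, all `g`), the lattice/isogeny
   dictionary (`exists_isogeny_range_tateModuleMap_eq P ℓ`, all `P`; in `…_of_facts` the named
   quotient fact `exists_quotient_isogeny P ℓ` from which it is proved), invariance of dimension
   under isogeny (`dim_eq_of_isIsogenous`; in `…_of_facts` supplied by its discharge
   `dim_eq_of_isIsogenous_holds` of `AbelianVarietyIsogenyProofs`), and `T_ℓ P` free and finitely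
   generated for `ℓ ≠ char K` (`module_free_tateModule`, `module_finite_tateModule`; in `…_of_facts` both are
   **proved** from the named fact `natCard_torsionPoints_of_isAlgClosed`, `#P[n](K̄) = n^{2g}` for
   `n` invertible in `K`, Mumford §6, via `Literature.NumberTheory.EllipticCurves.TateModule.free_of_finite_torsionBy`);
2. bridge data identifying `W, W'` with `A, A'` (`eW, heW, eW', heW'`, and `hHom`, `hHom'`: a
   non-zero homomorphism `A → A'`, resp. `A' → A`, yields an isogeny `E → E'`, resp. `E' → E`;
   cf. `WeierstrassCurve.nonempty_abelianVarietyBridge`, which provides all but `hHom'`);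
3. the dual-isogeny fact `Isogeny.nonempty_symm` for `(E', E)` (*AEC* III.6.1).

`Literature.AlgebraicGeometry.Motives.isIsogenous_of_finite_iff_exists_tateModule_hom_ne_zero_of_facts`: the same with
the bridge data packaged by the structure `WeierstrassCurve.AbelianVarietyBridge W W'` of
`Literature.NumberTheory.EllipticCurves.AbelianVarietyBridge`, required in the symmetric form
"some bridge `B` whose non-zero homomorphisms `B.A' → B.A` are isogenies `E' → E` as well"
(hypothesis `hbridge`; the named fact `WeierstrassCurve.nonempty_abelianVarietyBridge W W'`
asserts the existence of `B` with the compatibility for `B.A → B.A'` only — the same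
construction, *AEC* III.3.1, III.3.6, III.4.8, gives both), and the abelian-variety facts
quantified over all abelian varieties over `K`; and
`Literature.AlgebraicGeometry.Motives.isIsogenous_of_finite_iff_exists_tateModule_hom_ne_zero_of_named_facts`: the same with
`hbridge` literally the named fact `WeierstrassCurve.nonempty_abelianVarietyBridge_symm W W'`.
Granted discharges of its six named-fact hypotheses (`nonempty_abelianVarietyBridge_symm`,
`hasBinaryBiproduct`, `finite_isoClasses_of_finite`, `exists_quotient_isogeny`,
`natCard_torsionPoints_of_isAlgClosed`, `Isogeny.nonempty_symm`), this is the `_holds` theorem of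
the corrected isogeny criterion.

No statement specific to Tate's paper remains as a hypothesis: the Main Theorem's lattice lemma
is a theorem of the tree, and what is left is textbook theory of abelian varieties plus the
identification of a Weierstrass cubic with a one-dimensional abelian variety.

## References

* [Tate1966Endomorphisms] J. Tate, *Endomorphisms of abelian varieties over finite fields*,
  Invent. Math. 2 (1966), 134–144, §2 and Theorem 1.
* [Kieffer2024IsogenyGraphs] J. Kieffer, *Isogeny graphs of abelian varieties over finite
  fields* (2024), §1.2.4 (Lemma 1.2.23, Prop. 1.2.20); held.
* [Milne1986AbelianVarieties] J. S. Milne, *Abelian Varieties* (Cornell–Silverman 1986),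
  Cor. 18.9.
* [MumfordAV1970] D. Mumford, *Abelian Varieties* (1970), §6 (Proposition p. 64), §19 (p. 171).
* [SilvermanAEC2009] J. H. Silverman, *The Arithmetic of Elliptic Curves*, 2nd ed., III.6.1,
  III.7.4, III.7.7(a).
-/

noncomputable section

universe u

/-! ## `T_ℓ P` is free of finite rank for `ℓ ≠ char K`, from `#P[n](K̄) = n^{2g}` -/

namespace Literature.AlgebraicGeometry.Motives.AbelianVariety

variable {K : Type u} [Field K] (P : AbelianVariety K) (ℓ : ℕ) [Fact ℓ.Prime]

/-- For `n` invertible in `K`, the geometric `n`-torsion `P[n](K̄)` of an abelian variety is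
finite, granted the named fact `#P[n](K̄) = n^{2 dim P}`
(`natCard_torsionPoints_of_isAlgClosed`, Mumford, *Abelian Varieties*, §6, Proposition p. 64):
a type of non-zero `Nat.card` is finite. [cite: MumfordAV1970, §6 Application 3 (Proposition p. 64)] -/
theorem finite_geomTorsion_of_natCard_torsionPoints
    (h : P.natCard_torsionPoints_of_isAlgClosed (AlgebraicClosure K)) {n : ℤ}
    (hn : (n : K) ≠ 0) : Finite (P.geomTorsion n) := by
  refine Nat.finite_of_card_ne_zero ?_
  rw [P.natCard_geomTorsion h n hn]
  refine pow_ne_zero _ (Int.natAbs_ne_zero.mpr ?_)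
  rintro rfl
  exact hn (by simp)

/-- **`T_ℓ P` is free over `ℤ_ℓ` for `ℓ ≠ char K`** — the named fact
`module_free_tateModule P ℓ` (Mumford §19, p. 171) **proved** from `#P[n](K̄) = n^{2g}`
(`natCard_torsionPoints_of_isAlgClosed`, Mumford §6): `P[ℓ](K̄)` is finite, so
`T_ℓ P = lim P[ℓⁿ]` is finitely generated (Nakayama over the complete ring `ℤ_ℓ`) and
torsion-free over the PID `ℤ_ℓ`, hence free (`Literature.NumberTheory.EllipticCurves.TateModule.free_of_finite_torsionBy`).
[cite: MumfordAV1970, §19 p. 171] -/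
theorem module_free_tateModule_of_natCard_torsionPoints
    (h : P.natCard_torsionPoints_of_isAlgClosed (AlgebraicClosure K)) :
    module_free_tateModule P ℓ := by
  intro hℓ
  have hℓ' : ((ℓ : ℤ) : K) ≠ 0 := by rwa [Int.cast_natCast]
  exact Literature.NumberTheory.EllipticCurves.TateModule.free_of_finite_torsionBy (A := P.geomPoints) (p := ℓ)
    (P.finite_geomTorsion_of_natCard_torsionPoints h hℓ')

/-- **`T_ℓ P` is finitely generated over `ℤ_ℓ` for `ℓ ≠ char K`** — the named fact
`module_finite_tateModule P ℓ` (Mumford §19, p. 171), for `ℓ` invertible in `K`, **proved** from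
`#P[n](K̄) = n^{2g}` (`natCard_torsionPoints_of_isAlgClosed`, Mumford §6) by
`Literature.NumberTheory.EllipticCurves.TateModule.finite_of_finite_torsionBy`. [cite: MumfordAV1970, §19 p. 171] -/
theorem module_finite_tateModule_of_natCard_torsionPoints
    (h : P.natCard_torsionPoints_of_isAlgClosed (AlgebraicClosure K)) (hℓ : (ℓ : K) ≠ 0) :
    module_finite_tateModule P ℓ := by
  have hℓ' : ((ℓ : ℤ) : K) ≠ 0 := by rwa [Int.cast_natCast]
  exact Literature.NumberTheory.EllipticCurves.TateModule.finite_of_finite_torsionBy (A := P.geomPoints) (p := ℓ)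
    (P.finite_geomTorsion_of_natCard_torsionPoints h hℓ')

end Literature.AlgebraicGeometry.Motives.AbelianVariety

namespace Literature.AlgebraicGeometry.Motives

open WeierstrassCurve AbelianVariety CategoryTheory

variable {K : Type u} [Field K] {W W' : WeierstrassCurve K} {A A' : AbelianVariety K}
variable (ℓ : ℕ) [Fact ℓ.Prime]

variable (W W') in
/-- **Tate's isogeny criterion for elliptic curves over a finite field, from the theory of
abelian varieties.** The named fact
`Literature.Hodge.isIsogenous_of_finite_iff_exists_tateModule_hom_ne_zero W W' ℓ` (Tate 1966,
Theorem 1; *AEC* III.7.7(a)) follows from: the existence of the product abelian variety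
`A × A'` as a biproduct (`hprod`), the finiteness of isomorphism classes of abelian varieties of
each dimension over the finite field `K` (`hfin`, Milne 1986 Cor. 18.9), the lattice/isogeny
dictionary for every abelian variety over `K` (`hlat`, Kieffer Prop. 1.1.10–1.2.5), invariance of
dimension under isogeny (`hdim`), `T_ℓ` free and finitely generated for `ℓ ≠ char K` (`hfree`,
`hfinT`), bridge
data for `(W, A)`, `(W', A')` in both directions (`eW, heW, eW', heW', hHom, hHom'`) and the dual
isogeny for `(E', E)` (`hsymm`). Proof: a biproduct bicone `b` exists (`hprod`); Tate's lattice
lemma holds for `b.pt = A × A'` over the finite field `K` at `ℓ ≠ char K`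
(`tateSubspaceRealization_of_finite`); conclude by
`isIsogenous_of_finite_iff_exists_tateModule_hom_ne_zero_of_tateSubspaceRealization`.
Tate 1966, §2 and Theorem 1; Milne, *The Work of John Tate*, §4.3.1; Kieffer 2024, §1.2.4.
[folklore] -/
theorem isIsogenous_of_finite_iff_exists_tateModule_hom_ne_zero_of_abelianVariety_facts
    (hprod : hasBinaryBiproduct A A')
    (hfin : ∀ g : ℕ, finite_isoClasses_of_finite K g)
    (hlat : ∀ P : AbelianVariety K, exists_isogeny_range_tateModuleMap_eq P ℓ)
    (hdim : ∀ B P : AbelianVariety K, dim_eq_of_isIsogenous (A := B) (B := P))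
    (hfree : ∀ P : AbelianVariety K, module_free_tateModule P ℓ)
    (hfinT : ∀ P : AbelianVariety K, (ℓ : K) ≠ 0 → module_finite_tateModule P ℓ)
    (eW : A.geomPoints ≃+ W.geomPoints)
    (heW : ∀ (σ : Field.absoluteGaloisGroup K) (P : A.geomPoints), eW (σ • P) = σ • eW P)
    (eW' : A'.geomPoints ≃+ W'.geomPoints)
    (heW' : ∀ (σ : Field.absoluteGaloisGroup K) (P : A'.geomPoints), eW' (σ • P) = σ • eW' P)
    (hHom : ∀ f : A ⟶ A', f ≠ 0 → W.IsIsogenous W')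
    (hHom' : ∀ f : A' ⟶ A, f ≠ 0 → W'.IsIsogenous W)
    (hsymm : Isogeny.nonempty_symm (W := W') (W' := W)) :
    isIsogenous_of_finite_iff_exists_tateModule_hom_ne_zero W W' ℓ := by
  obtain ⟨b, hb⟩ := exists_binaryBicone_total A A' hprod
  refine isIsogenous_of_finite_iff_exists_tateModule_hom_ne_zero_of_tateSubspaceRealization W W'
    ℓ b hb (fun {_} hℓ ↦ ?_) eW heW eW' heW' hHom hHom' hsymm
  exact tateSubspaceRealization_of_finite b.pt ℓ hℓ (hfin _) (hlat _) (fun B ↦ hdim B b.pt)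
    (hfree _) (hfinT _ hℓ)

variable (W W') in
/-- **The corrected isogeny criterion from named facts only.** For Weierstrass curves `W, W'`
over `K` and a prime `ℓ`: granted (1) bridge data `B : AbelianVarietyBridge W W'` (abelian
varieties `B.A, B.A'` with `Γ_K`-equivariant `B.A(K̄) ≅ E(K̄)`, `B.A'(K̄) ≅ E'(K̄)`, non-zero
homomorphisms `B.A → B.A'` being isogenies `E → E'`) which are symmetric — non-zero
homomorphisms `B.A' → B.A` are isogenies `E' → E` too (`hbridge`; *AEC* III.3.1, III.3.6,
III.4.8 for both orders of the pair); (2) the five abelian-variety facts of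
`isIsogenous_of_finite_iff_exists_tateModule_hom_ne_zero_of_abelianVariety_facts`, quantified
over all abelian varieties over `K` (`hprod`, `hfin`; the quotient fact
`AbelianVariety.exists_quotient_isogeny`, `hquot`, in place of its consequence `hlat`; and
`#P[n](K̄) = n^{2 dim P}` for `n` invertible in `K`, `hcard`, the named fact
`natCard_torsionPoints_of_isAlgClosed` of Mumford §6, in place of its consequences `hfree`, `hfinT`
— `module_free_tateModule_of_natCard_torsionPoints`,
`module_finite_tateModule_of_natCard_torsionPoints`; invariance of dimension under isogeny is the
discharged fact `dim_eq_of_isIsogenous_holds`); (3) the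
dual isogeny for `(E', E)` (`hsymm`, `Isogeny.nonempty_symm`, *AEC* III.6.1) — the named fact
`isIsogenous_of_finite_iff_exists_tateModule_hom_ne_zero W W' ℓ` holds (Tate 1966, Theorem 1;
*AEC* III.7.7(a)). A finite field is perfect (`PerfectField.ofFinite`), so the bridge applies.
[folklore] -/
theorem isIsogenous_of_finite_iff_exists_tateModule_hom_ne_zero_of_facts
    (hbridge : ∀ [PerfectField K] [W.IsElliptic] [W'.IsElliptic],
      ∃ B : AbelianVarietyBridge W W', ∀ f : B.A' ⟶ B.A, f ≠ 0 →
        ∃ ψ : Isogeny W' W, ∀ P : B.A'.geomPoints,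
          ψ (B.e' P) = B.e (Hom.geomPointsMap f P))
    (hprod : ∀ A A' : AbelianVariety K, hasBinaryBiproduct A A')
    (hfin : ∀ g : ℕ, finite_isoClasses_of_finite K g)
    (hquot : ∀ P : AbelianVariety K, exists_quotient_isogeny P ℓ)
    (hcard : ∀ P : AbelianVariety K, P.natCard_torsionPoints_of_isAlgClosed (AlgebraicClosure K))
    (hsymm : Isogeny.nonempty_symm (W := W') (W' := W)) :
    isIsogenous_of_finite_iff_exists_tateModule_hom_ne_zero W W' ℓ := by
  intro _ _ _ hℓ
  haveI : PerfectField K := PerfectField.ofFinite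
  obtain ⟨B, hB⟩ := hbridge
  exact isIsogenous_of_finite_iff_exists_tateModule_hom_ne_zero_of_abelianVariety_facts W W' ℓ
    (hprod B.A B.A') hfin (fun P ↦ exists_isogeny_range_tateModuleMap_eq_of_quotient P ℓ (hquot P))
    (fun _ _ ↦ dim_eq_of_isIsogenous_holds)
    (fun P ↦ P.module_free_tateModule_of_natCard_torsionPoints ℓ (hcard P))
    (fun P hℓ' ↦ P.module_finite_tateModule_of_natCard_torsionPoints ℓ (hcard P) hℓ')
    B.e B.e_smul B.e' B.e'_smul
    (fun f hf ↦ isIsogenous_of_exists_isogeny_comp B.exists_isogeny f hf)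
    (fun f hf ↦ by obtain ⟨ψ, -⟩ := hB f hf; exact ⟨ψ⟩) hsymm hℓ

variable (W W') in
/-- **The corrected isogeny criterion from named facts only, bridge in named form.** The same as
`isIsogenous_of_finite_iff_exists_tateModule_hom_ne_zero_of_facts` with the symmetric bridge
hypothesis given by the named fact `WeierstrassCurve.nonempty_abelianVarietyBridge_symm W W'`
of `Literature.NumberTheory.EllipticCurves.AbelianVarietyBridge` (Silverman, *AEC*, III.3.1(c),
III.3.6, III.4.8, III.4.9). With the discharges of the six named facts in its hypotheses
(`nonempty_abelianVarietyBridge_symm`, `hasBinaryBiproduct`, `finite_isoClasses_of_finite`,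
`exists_quotient_isogeny`, `natCard_torsionPoints_of_isAlgClosed`, `Isogeny.nonempty_symm`) this
is `isIsogenous_of_finite_iff_exists_tateModule_hom_ne_zero_holds`. [folklore] -/
theorem isIsogenous_of_finite_iff_exists_tateModule_hom_ne_zero_of_named_facts
    (hbridge : nonempty_abelianVarietyBridge_symm W W')
    (hprod : ∀ A A' : AbelianVariety K, hasBinaryBiproduct A A')
    (hfin : ∀ g : ℕ, finite_isoClasses_of_finite K g)
    (hquot : ∀ P : AbelianVariety K, exists_quotient_isogeny P ℓ)
    (hcard : ∀ P : AbelianVariety K, P.natCard_torsionPoints_of_isAlgClosed (AlgebraicClosure K))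
    (hsymm : Isogeny.nonempty_symm (W := W') (W' := W)) :
    isIsogenous_of_finite_iff_exists_tateModule_hom_ne_zero W W' ℓ :=
  isIsogenous_of_finite_iff_exists_tateModule_hom_ne_zero_of_facts W W' ℓ
    (fun {_ _ _} ↦ hbridge) hprod hfin hquot hcard hsymm

end Literature.AlgebraicGeometry.Motives
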